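import Mathlib

/-!
# Quotient predecessor: the structural brick `G · Q = P`

For `P = ∏ u_i`, `Q = ∏ v_j` (all `v_j` with constant term `1`, so `Q` is a unit of
`MvPowerSeries (Fin 2) ℂ`) and `G = P · Q⁻¹`, every support point `e` of `G` outside the support
of `P` has a *predecessor*: a nonzero support point `b ≤ e` of `Q` with `e - b` again in the
support of `G`.  Proof: `0 = coeff_e P = coeff_e (G · Q) = Σ_{i + j = e} coeff_i G · coeff_j Q`;
the term `(i, j) = (e, 0)` equals `coeff_e G ≠ 0`, so some other term `(e - b, b)`, `b ≠ 0`,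
is nonzero.
-/

set_option linter.dupNamespace false

namespace Summit.ValiantsHypothesis.ValiantsHypothesis.Theorems.TwoProducts.QuotientPredecessor

open scoped BigOperators
open MvPolynomial

/-- The coercion `MvPolynomial → MvPowerSeries` commutes with finite products. -/
theorem coe_finset_prod {ι : Type*} (s : Finset ι) (f : ι → MvPolynomial (Fin 2) ℂ) :
    (((∏ i ∈ s, f i : MvPolynomial (Fin 2) ℂ)) : MvPowerSeries (Fin 2) ℂ) =
      ∏ i ∈ s, ((f i : MvPolynomial (Fin 2) ℂ) : MvPowerSeries (Fin 2) ℂ) := by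
  simp only [← coeToMvPowerSeries.ringHom_apply, map_prod]

/-- The constant coefficient of a finite product of polynomials with constant term `1` is `1`. -/
theorem coeff_zero_prod_eq_one {ι : Type*} (s : Finset ι) (f : ι → MvPolynomial (Fin 2) ℂ)
    (hf : ∀ i ∈ s, MvPolynomial.coeff 0 (f i) = 1) :
    MvPolynomial.coeff 0 (∏ i ∈ s, f i) = 1 := by
  rw [← constantCoeff_eq, map_prod]
  exact Finset.prod_eq_one fun i hi => by rw [constantCoeff_eq]; exact hf i hi

/-- **Quotient predecessor.**  With `Q = ∏ v_j` of constant term `1` and `G = (∏ u_i) · Q⁻¹`, every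
support point `e` of `G` outside the support of `∏ u_i` dominates a nonzero support point `b` of
`∏ v_j` with `e - b` again a support point of `G` (read off from `coeff_e (G · Q) = coeff_e P = 0`). -/
theorem stub_quotientPredecessor : ∀ (k m : ℕ) (u : Fin k → MvPolynomial (Fin 2) ℂ)
    (v : Fin m → MvPolynomial (Fin 2) ℂ), (∀ j, MvPolynomial.coeff 0 (v j) = 1) →
    ∀ e : Fin 2 →₀ ℕ, e ∉ (∏ i, u i).support →
      MvPowerSeries.coeff e ((∏ i, ((u i : MvPolynomial (Fin 2) ℂ) : MvPowerSeries (Fin 2) ℂ)) *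
          (∏ j, ((v j : MvPolynomial (Fin 2) ℂ) : MvPowerSeries (Fin 2) ℂ))⁻¹) ≠ 0 →
      ∃ b ∈ (∏ j, v j).support, b ≠ 0 ∧ b ≤ e ∧
        MvPowerSeries.coeff (e - b) ((∏ i, ((u i : MvPolynomial (Fin 2) ℂ) : MvPowerSeries (Fin 2) ℂ)) *
          (∏ j, ((v j : MvPolynomial (Fin 2) ℂ) : MvPowerSeries (Fin 2) ℂ))⁻¹) ≠ 0 := by
  intro k m u v hv e he hG
  classical
  set P : MvPowerSeries (Fin 2) ℂ :=
    ∏ i, ((u i : MvPolynomial (Fin 2) ℂ) : MvPowerSeries (Fin 2) ℂ) with hP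
  set Q : MvPowerSeries (Fin 2) ℂ :=
    ∏ j, ((v j : MvPolynomial (Fin 2) ℂ) : MvPowerSeries (Fin 2) ℂ) with hQ
  have hPcoe : P = ((∏ i, u i : MvPolynomial (Fin 2) ℂ) : MvPowerSeries (Fin 2) ℂ) := by
    rw [hP, coe_finset_prod]
  have hQcoe : Q = ((∏ j, v j : MvPolynomial (Fin 2) ℂ) : MvPowerSeries (Fin 2) ℂ) := by
    rw [hQ, coe_finset_prod]
  -- the constant coefficient of `Q` is `1`, so `Q⁻¹ · Q = 1`
  have hQ0 : MvPowerSeries.coeff (0 : Fin 2 →₀ ℕ) Q = 1 := by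
    rw [hQcoe, MvPolynomial.coeff_coe]
    exact coeff_zero_prod_eq_one _ _ fun j _ => hv j
  have hGQ : P * Q⁻¹ * Q = P := by
    rw [mul_assoc, MvPowerSeries.inv_mul_cancel _
      (by rw [← MvPowerSeries.coeff_zero_eq_constantCoeff_apply, hQ0]; exact one_ne_zero), mul_one]
  -- `coeff_e P = 0`, expanded along the antidiagonal of `e`
  have hPe : MvPowerSeries.coeff e P = 0 := by
    rw [hPcoe, MvPolynomial.coeff_coe]
    exact MvPolynomial.notMem_support_iff.mp he
  rw [← hGQ, MvPowerSeries.coeff_mul] at hPe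
  have hmem : (e, (0 : Fin 2 →₀ ℕ)) ∈ Finset.HasAntidiagonal.antidiagonal e := by simp
  rw [← Finset.add_sum_erase _ _ hmem, hQ0, mul_one] at hPe
  have hrest : ∑ p ∈ (Finset.HasAntidiagonal.antidiagonal e).erase (e, 0),
      MvPowerSeries.coeff p.1 (P * Q⁻¹) * MvPowerSeries.coeff p.2 Q ≠ 0 := by
    intro h
    rw [h, add_zero] at hPe
    exact hG hPe
  obtain ⟨p, hp, hpne⟩ := Finset.exists_ne_zero_of_sum_ne_zero hrest
  rw [Finset.mem_erase, Finset.HasAntidiagonal.mem_antidiagonal] at hp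
  refine ⟨p.2, ?_, ?_, ?_, ?_⟩
  · rw [MvPolynomial.mem_support_iff, ← MvPolynomial.coeff_coe, ← hQcoe]
    exact right_ne_zero_of_mul hpne
  · intro h2
    apply hp.1
    have h1 : p.1 = e := by simpa [h2] using hp.2
    exact Prod.ext h1 h2
  · rw [← hp.2]
    exact le_add_self
  · have h12 : e - p.2 = p.1 := by rw [← hp.2, add_tsub_cancel_right]
    rw [h12]
    exact left_ne_zero_of_mul hpne

end Summit.ValiantsHypothesis.ValiantsHypothesis.Theorems.TwoProducts.QuotientPredecessor
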